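import Literature.MathematicalPhysics.QuantumFieldTheory.Balaban1983to89.B3MultiscaleFields
import Literature.MathematicalPhysics.QuantumFieldTheory.Balaban1983to89.HiggsRescaling

/-!
# `Balaban1983to89.B2Eq21FirstStep` — T. Bałaban, *(Higgs)₂,₃ quantum fields in a finite volume. II. An upper bound*,
Commun. Math. Phys. **86** (1982) 555–594 [Balaban1982Higgs2], (2.1) p. 556 (= part I [Balaban1982Higgs1] (3.7)
p. 613): the integral of the FIRST RENORMALIZATION STEP `T^ε_{a,L}[T^ε_{a,L,A}[exp(−S^ε)]]` rescaled to the unit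
lattice, as a CONCRETE definition over the (Higgs)₂,₃ carriers `…HiggsLattice` / `…HiggsAveraging` / `…HiggsRescaling`,
with the two computations the page performs — the assembly of the exponent and its rescaling — PROVED

statement-level skeleton of published theorems with citation tags; proofs where landed; nothing here is a claim about the Yang–Mills mass gap

PDF held: `paper:balaban1982-cmp86-higgs23-ii` (journal page = PDF page + 554); part I `paper:balaban1982-cmp85-higgs23-i`
(+ 602).  Displays read from the ×2 renders `run/shared/lean/pub/pub-balaban/b2b-balaban-ref1/pages/1982-cmp86-higgs23-II/
1982-cmp86-higgs23-II-p002-x2.png` (II p. 556) and `…/1982-cmp85-higgs23-I/1982-cmp85-higgs23-I-p005,p006,p011-x2.png`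
(I pp. 607, 608, 613), never from the OCR layer.

CITATION HEADER (lean-in-tree rule).  lit-balaban typed skeleton (HOME `run/shared/lean/pub/lit-balaban/`), SKELETON rows
**B2.Eq2.1** (II (2.1), the assembled first-step display; owner r02) and the (3.7) member of **B1.Eq3.7** (I (3.7); owners
r01/r12/r14 — r12's `B1Sect3Statements.action37` is the SCHEMATIC form of the same bracket over abstract `Q`, `Q(A)` and
quadratic forms; this module is the concrete instance and is not a restatement of it).  WHAT IS REPRODUCED: II p. 556,
verbatim: *"We have to calculate the integral T^ε_{a,L}[T^ε_{a,L,A}[exp(−S^ε)]]. We rescale it from ε-lattice T_ε to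
1-lattice T₁ and we get the integral (I.3.7). Omitting the constant factors we have
∫dA∫dφ exp[−½aL^{d−2} Σ_{y∈T'₁} |B(y)−(QA)(y)|² − ½ Σ_{b⊂T₁} |(∂A)(b)|² − ½μ₀²ε² Σ_{x∈T₁} |A(x)|²
− ½aL^{d−2} Σ_{y∈T'₁} |ψ(y)−(Q(A)φ)(y)|² − ½ Σ_{b⊂T₁} |(D_Aφ)(b)|² − ½m²ε² Σ_{x∈T₁} |φ(x)|² − λε^{4−d} Σ_{x∈T₁} |φ(x)|⁴
− ½δm²ε² Σ_{x∈T₁} |φ(x)|² − E] (2.1)"*.  Typed CONCRETELY: (§1) the device of I p. 608 *"The renormalization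
transformations for vector fields will be obtained by taking N = d and an external vector field A = 0"* (the vector
field as the `ℝ^d`-valued site function `x ↦ (A_μ(x))_μ` = the tree's `B3MultiscaleFields.toSite`, reused; `linAvg` = the
averaging (2.7) at `A = 0`, with `avgQ_zero : Q(0) = Q` PROVED); (§2) the bracket of (2.1)/(I.3.7) as a function `firstStepExponent` of the block fields
`B, ψ` (level 1) and the fine fields `A, φ` (level 0) on ANY lattice of the family — the two Gaussian terms of the
transformations (2.4)–(2.7) with the printed precision `a(L·mesh)^{d−2}` (`B1RT.prec`) minus the action (1.11)
(`HiggsLattice.action`) — so that on the ε-lattice it is the exponent of the integrand of `T^ε_{a,L}[T^ε_{a,L,A}[e^{−S^ε}]]`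
and on the unit lattice (`mesh = 1`, constants `m₀²ε² = (m² + δm²)ε²`, `μ₀²ε²`, `λε^{4−d}`, `eε^{(4−d)/2}` =
`Couplings.scaleBy`/`ChargeData.scaleBy` at `s = ε⁻¹`) it is LITERALLY the printed bracket (`firstStepExponent_unit`);
(§3) the display (2.1) itself, `display21` = `∫d(A,φ) exp[firstStepExponent]` (product Lebesgue measure), and I (3.7)
with its characteristic functions as an explicit weight (`display37`); (§4) PROVED: `doubleRT_exp_neg_action` — on any
lattice, `T_{a,L}[T_{a,L,A}[χ·e^{−S}]](B,ψ) = const · ∫dA∫dφ χ exp[firstStepExponent]` (the two block kernels (2.5)–(2.6)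
are `const·exp` of the two Gaussian terms: `blockKernel_eq_const_mul_exp`), and `firstStepExponent_rescale` — under the
canonical rescaling (1.22) of all four fields from the `sε`- to the `ε`-lattice the bracket is INVARIANT when the constants
are rescaled as on I p. 607 (`HiggsRescaling.action_rescale` for the action, `avgQ_rescale` for `Q(A)`: the Gaussian
terms are scale-free); (§6) PROVED: the linear change of variables `(A,φ) = (σA', σφ')`, `σ = s^{(d−2)/2}`, in
`∫dA∫dφ` (bond relabeling is measure preserving, `MeasureTheory.volume_measurePreserving_piCongrLeft`; the homothety
scales Lebesgue measure, `MeasureTheory.Measure.integral_comp_smul`) and the resulting equality of INTEGRALS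
`doubleRT_rescale`: `T T[χe^{−S^ε}]` at rescaled block fields `= rescaleConst · ∫dA'∫dφ' χ · exp E^{sε}` — at `s = ε⁻¹`
the sentence *"We rescale it from ε-lattice T_ε to 1-lattice T₁ and we get the integral (I.3.7)"* with its `const`.
DELIBERATELY NOT HERE: the restrictions χ₀ of (I.3.8)–(I.3.9) as concrete operators (`B1Sect3Statements.SmallFieldUnit`
types them over abstract size functions; here `χ₀` is an explicit weight); everything after (2.1) (positivity
(2.2)–(2.3): `B2Sect2Statements`, `B2LargeField`); convergence of the integrals (not part of the displays).
SIZE: one module for the two rows because §5–§6 consume §1–§4 directly (cf. `B1RT`, 679 l.).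
Unit `lit-balaban-typer` gen 2 (literature-prover-lit-balaban-typer-g2-0); HOME/FILED.md records the proposal.
-/

open scoped BigOperators
open _root_.MeasureTheory _root_.Real

namespace Literature.MathematicalPhysics.QuantumFieldTheory.Balaban1983to89.B2Eq21FirstStep

open Literature.MathematicalPhysics.QuantumFieldTheory.Balaban1983to89.HiggsLattice
open Literature.MathematicalPhysics.QuantumFieldTheory.Balaban1983to89.HiggsAveraging
open Literature.MathematicalPhysics.QuantumFieldTheory.Balaban1983to89.HiggsRescaling
open Literature.MathematicalPhysics.QuantumFieldTheory.Balaban1983to89.B3MultiscaleFields (toSite)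

variable {P : Params}

/-! ## 1. Vector fields as `ℝ^d`-valued scalar fields; the averaging `Q = Q(0)` (I p. 608) -/

section VectorRT

variable {k N : ℕ}

/-! I p. 608, verbatim: *"The renormalization transformations for vector fields will be obtained by taking N = d and
an external vector field A = 0, so we will not consider them separately."* — the vector field `A` is regarded as the
`ℝ^d`-valued site function `x ↦ (A_μ(x))_μ`; this identification is the tree's `B3MultiscaleFields.toSite` (reader r15,
III (1.1)–(1.3)), REUSED here (not re-declared). -/

/-- The averaging operator (2.7) p. 608 AT `A = 0` (the case used for vector fields, p. 608): the plain block average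
`(Qf)(y) = L^{−d} Σ_{x∈B(y)} f(x)` of a function with values in a real vector space (`U(0) = 1`). [cite: Balaban1982Higgs1, (2.7) p.608] -/
noncomputable def linAvg {V : Type*} [AddCommGroup V] [Module ℝ V] (f : Site P k → V) : Site P (k + 1) → V :=
  fun y => (((P.L : ℝ) ^ P.d)⁻¹) • ∑ x ∈ block y, f x

/-- `Q(0) = Q`: at the external field `A = 0` the covariant average (2.7) (`HiggsAveraging.avgQ`, transports
`U(A(Γ_{y,x}))`) IS the plain block average (`U(0) = 1`, p. 605) — the sense of *"taking … A = 0"* on p. 608.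
PROVED. [cite: Balaban1982Higgs1, (2.7) p.608] -/
theorem avgQ_zero (C : ChargeData N) (φ : ScalarField P k N) : avgQ C (0 : VecField P 0) φ = linAvg φ := by
  funext y
  rw [avgQ_apply]
  unfold linAvg
  congr 1
  refine Finset.sum_congr rfl fun x _ => ?_
  rw [show contourSum (0 : VecField P 0) (toFinest y) (toFinest x) = 0 by simp [contourSum, segSum],
    ChargeData.U_zero]
  rfl

end VectorRT

/-! ## 2. The bracket of II (2.1) / I (3.7): the exponent of the first renormalization step -/

section Exponent

variable {N : ℕ}

/-- **The exponent of II (2.1) p. 556 / I (3.7) p. 613**, as a function of the block fields `B, ψ` (on `T^{(1)}`) and the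
fine fields `A, φ` (on `T^{(0)}`) of a lattice of the family `P` with charge data `C` and couplings `c`:
`E(B,ψ;A,φ) = −½κ Σ_{y∈T^{(1)}} |B(y) − (QA)(y)|² − ½κ Σ_{y∈T^{(1)}} |ψ(y) − (Q(A)φ)(y)|² − S(A,φ)`, `κ = a(L·mesh₀)^{d−2}`
(`B1RT.prec`, the precision of (2.6) at `k = 0`), `S` = the action (1.11) (`HiggsLattice.action`), `QA` the plain and
`Q(A)φ` the covariant block average (2.7).  On the ε-lattice this is the exponent of the integrand of
`T^ε_{a,L}[T^ε_{a,L,A}[exp(−S^ε)]]` (`doubleRT_exp_neg_action`); on the UNIT lattice (`mesh₀ = 1`, so `κ = aL^{d−2}` and all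
weights `η^d = 1`) with the constants `c = (m₀²ε², λε^{4−d}, μ₀²ε², E)`, `m₀² = m² + δm²`, `e ↦ eε^{(4−d)/2}` it is the printed
bracket of (2.1) symbol by symbol (`firstStepExponent_unit`). [cite: Balaban1982Higgs2, (2.1) p.556] -/
noncomputable def firstStepExponent (C : ChargeData N) (c : Couplings) (a : ℝ) (B : VecField P 1) (ψ : ScalarField P 1 N)
    (A : VecField P 0) (φ : ScalarField P 0 N) : ℝ :=
  -(B1RT.prec a (P.mesh 1) P.d / 2) * ∑ y : Site P 1, ‖toSite B y - linAvg (toSite A) y‖ ^ 2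
    - B1RT.prec a (P.mesh 1) P.d / 2 * ∑ y : Site P 1, ‖ψ y - avgQ C A φ y‖ ^ 2
    - action C c A φ

/-- The Gaussian term of II (2.1) for the vector fields written in coordinates, as printed:
`|B(y) − (QA)(y)|² = Σ_μ (B_μ(y) − L^{−d} Σ_{x∈B(y)} A_μ(x))²` (Euclidean norm of `ℝ^d`). PROVED. [cite: Balaban1982Higgs2, (2.1) p.556] -/
theorem norm_sq_toSite_sub_linAvg (B : VecField P 1) (A : VecField P 0) (y : Site P 1) :
    ‖toSite B y - linAvg (toSite A) y‖ ^ 2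
      = ∑ μ : Fin P.d, (B ⟨y, μ⟩ - (((P.L : ℝ) ^ P.d)⁻¹) * ∑ x ∈ block y, A ⟨x, μ⟩) ^ 2 := by
  rw [EuclideanSpace.real_norm_sq_eq]
  refine Finset.sum_congr rfl fun μ _ => ?_
  simp [toSite, linAvg, Finset.sum_apply, Finset.mul_sum]

end Exponent

/-! ## 3. The displays II (2.1) and I (3.7) as integrals; the unit lattice and its constants -/

section Displays

variable {N : ℕ}

/-- **II (2.1)** p. 556, verbatim: *"Omitting the constant factors we have ∫dA∫dφ exp[−½aL^{d−2}Σ_{y∈T'₁}|B(y)−(QA)(y)|²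
− ½Σ_{b⊂T₁}|(∂A)(b)|² − ½μ₀²ε²Σ_{x∈T₁}|A(x)|² − ½aL^{d−2}Σ_{y∈T'₁}|ψ(y)−(Q(A)φ)(y)|² − ½Σ_{b⊂T₁}|(D_Aφ)(b)|²
− ½m²ε²Σ|φ(x)|² − λε^{4−d}Σ|φ(x)|⁴ − ½δm²ε²Σ|φ(x)|² − E] (2.1)"* — typed reading: the function of the block fields
`(B, ψ) ↦ ∫ d(A,φ) exp E(B,ψ;A,φ)` (product Lebesgue measure on `(bonds → ℝ) × (sites → ℝ^N)` of the lattice `P₁`, I p. 605),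
to be read at the unit lattice `P₁ = P.scaleBy ε⁻¹` with the rescaled constants (`unitLattice_mesh_zero`,
`couplings_scaleBy_inv`).  Convergence of the integral is not part of the display. [cite: Balaban1982Higgs2, (2.1) p.556] -/
noncomputable def display21 (P₁ : Params) (C₁ : ChargeData N) (c₁ : Couplings) (a : ℝ) (B : VecField P₁ 1)
    (ψ : ScalarField P₁ 1 N) : ℝ :=
  ∫ Φ : VecField P₁ 0 × ScalarField P₁ 0 N, Real.exp (firstStepExponent C₁ c₁ a B ψ Φ.1 Φ.2)

/-- **I (3.7)** p. 613 [PDF 11], verbatim: *"After the rescaling the integral gets the following form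
const ∫dA∫dφ χ₀(A)χ₀(φ) exp[−½aL^{d−2}Σ_{y∈T'₁}|B(y)−(QA)(y)|² − ½⟨A,(−Δ+μ₀²ε²)A⟩ − ½aL^{d−2}Σ_{y∈T'₁}|ψ(y)−(Q(A)φ)(y)|²
− ½⟨φ,(−Δ_A+m²ε²)φ⟩ − ½δm²ε²Σ_{x∈T₁}|φ(x)|² − λε^{4−d}Σ_{x∈T₁}|φ(x)|⁴ − E], (3.7) where the characteristic functions
χ₀(A)χ₀(φ) correspond now to the restrictions"* (3.8)–(3.9) — typed reading: the same integral as (2.1) with the weight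
`χ₀(A)χ₀(φ)` (an explicit argument: the indicator of (3.8)–(3.9), typed as `B1Sect3Statements.SmallFieldUnit` over the
sizes `|A(x)|, |(ΔA)(x)|, |φ(x)|, |(Δ_Aφ)(x)|`) and the constant `const`. [cite: Balaban1982Higgs1, (3.7) p.613] -/
noncomputable def display37 (P₁ : Params) (C₁ : ChargeData N) (c₁ : Couplings) (a const : ℝ)
    (χ₀ : VecField P₁ 0 → ScalarField P₁ 0 N → ℝ) (B : VecField P₁ 1) (ψ : ScalarField P₁ 1 N) : ℝ :=
  const * ∫ Φ : VecField P₁ 0 × ScalarField P₁ 0 N, χ₀ Φ.1 Φ.2 * Real.exp (firstStepExponent C₁ c₁ a B ψ Φ.1 Φ.2)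

/-- (3.7) at `χ₀ ≡ 1`, `const = 1` is (2.1) (II p. 556: the restrictions of part II are introduced differently, after
(2.1)). [cite: Balaban1982Higgs2, (2.1) p.556] -/
theorem display37_one (P₁ : Params) (C₁ : ChargeData N) (c₁ : Couplings) (a : ℝ) (B : VecField P₁ 1)
    (ψ : ScalarField P₁ 1 N) : display37 P₁ C₁ c₁ a 1 (fun _ _ => 1) B ψ = display21 P₁ C₁ c₁ a B ψ := by
  simp [display37, display21]

/-- The unit lattice of I p. 613 (*"we make the transformations (1.22), (1.23) with η = ε, δ = 1"*): the rescaled family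
`P.scaleBy ε⁻¹` has spacing `1` at level `0` … [cite: Balaban1982Higgs1, (3.7) p.613] -/
theorem unitLattice_mesh_zero (P : Params) : (P.scaleBy P.ε⁻¹ (inv_pos.mpr P.hε)).mesh 0 = 1 := by
  rw [mesh_scaleBy]
  simp [Params.mesh, inv_mul_cancel₀ P.hε.ne']

/-- … and spacing `L` at level `1` (the block lattice `T'₁`), so that the precision of (2.6) there is `aL^{d−2}` as printed
in (2.1)/(3.7). [cite: Balaban1982Higgs1, (3.7) p.613] -/
theorem unitLattice_prec (P : Params) (a : ℝ) :
    B1RT.prec a ((P.scaleBy P.ε⁻¹ (inv_pos.mpr P.hε)).mesh 1) P.d = a * (P.L : ℝ) ^ ((P.d : ℤ) - 2) := by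
  have h : P.ε⁻¹ * P.mesh 1 = (P.L : ℝ) := by
    unfold Params.mesh
    rw [pow_one, mul_comm, mul_assoc, mul_inv_cancel₀ P.hε.ne', mul_one]
  rw [mesh_scaleBy, h, B1RT.prec_eq]

/-- The constants of (2.1)/(3.7): at `s = ε⁻¹` the rescaled couplings of I p. 607 (`Couplings.scaleBy`) are
`m₀²ε²` (= `m²ε² + δm²ε²`), `λε^{4−d}`, `μ₀²ε²`, `E`, and the charge is `eε^{(4−d)/2}` — the `ε`-dependence displayed in
(2.1). PROVED. [cite: Balaban1982Higgs2, (2.1) p.556] -/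
theorem couplings_scaleBy_inv (c : Couplings) (C : ChargeData N) (d : ℕ) {ε : ℝ} (hε : 0 < ε) :
    (c.scaleBy d ε⁻¹).m0sq = c.m0sq * ε ^ 2 ∧ (c.scaleBy d ε⁻¹).lam = c.lam * ε ^ (4 - (d : ℝ))
      ∧ (c.scaleBy d ε⁻¹).mu0sq = c.mu0sq * ε ^ 2 ∧ (c.scaleBy d ε⁻¹).E = c.E
      ∧ (C.scaleBy d ε⁻¹).e = C.e * ε ^ ((4 - (d : ℝ)) / 2) := by
  have h1 : (ε⁻¹) ^ (-(4 - (d : ℝ))) = ε ^ (4 - (d : ℝ)) := by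
    rw [Real.inv_rpow hε.le, Real.rpow_neg hε.le, inv_inv]
  have h2 : (ε⁻¹) ^ (-(4 - (d : ℝ)) / 2) = ε ^ ((4 - (d : ℝ)) / 2) := by
    rw [Real.inv_rpow hε.le, show -(4 - (d : ℝ)) / 2 = -((4 - (d : ℝ)) / 2) by ring, Real.rpow_neg hε.le, inv_inv]
  refine ⟨?_, ?_, ?_, rfl, ?_⟩
  · simp [Couplings.scaleBy]
  · simp only [Couplings.scaleBy, h1]
  · simp [Couplings.scaleBy]
  · simp only [ChargeData.scaleBy, h2]

end Displays

/-! ## 4. PROVED: `T_{a,L}[T_{a,L,A}[χ e^{−S}]]` has the integrand `const · χ · exp E` (II p. 556, I (3.6)→(3.7)) -/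

section DoubleRT

variable {N : ℕ}

/-- The block kernel (2.5)–(2.6) p. 608 is a constant times the exponential of minus its Gaussian quadratic term:
`Π_{y∈Y} (κ/2π)^{n/2} exp(−½κ|ψ(y) − (mφ)(y)|²) = ((κ/2π)^{n/2})^{|Y|} · exp(−½κ Σ_{y∈Y} |ψ(y) − (mφ)(y)|²)`
(`n = dim V`). PROVED. [cite: Balaban1982Higgs1, (2.5)–(2.6) p.608] -/
theorem blockKernel_eq_const_mul_exp {V : Type*} [NormedAddCommGroup V] [InnerProductSpace ℝ V] {X Y : Type*}
    [Fintype Y] (κ : ℝ) (m : (X → V) → Y → V) (ψ : Y → V) (φ : X → V) :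
    B1RT.blockKernel κ m ψ φ
      = ((κ / (2 * π)) ^ ((Module.finrank ℝ V : ℝ) / 2)) ^ Fintype.card Y
          * Real.exp (-(κ / 2) * ∑ y, ‖ψ y - m φ y‖ ^ 2) := by
  rw [B1RT.blockKernel_eq]
  simp only [B1RT.rtKernel_eq, Finset.prod_mul_distrib, Finset.prod_const, Finset.card_univ, Finset.mul_sum,
    Real.exp_sum]

/-- II p. 556 / I (3.6) p. 613: the DOUBLE transformation `T^ε_{a,L}[T^ε_{a,L,A}[ρ]]` of a density `ρ(A, φ)` of the fine
fields — the scalar-field transformation (2.4) in `φ` at the external field `A` (`HiggsAveraging.renormTransf`: kernel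
(2.5)–(2.6) with the covariant average `Q(A)`), followed by the vector-field transformation in `A` (I p. 608: `N = d`,
`A = 0`, i.e. the block kernel (2.5)–(2.6) with the plain average `Q` on `x ↦ (A_μ(x))_μ`), both at the precision
`a(L·mesh₀)^{d−2}` of (2.6) at `k = 0`; a function of the block fields `(B, ψ)` on `T^{(1)}`. Integrals = product Lebesgue
measure (I p. 605). [cite: Balaban1982Higgs2, (2.1) p.556] -/
noncomputable def doubleRT (C : ChargeData N) (a : ℝ) (ρ : VecField P 0 → ScalarField P 0 N → ℝ) (B : VecField P 1)
    (ψ : ScalarField P 1 N) : ℝ :=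
  ∫ A : VecField P 0,
    B1RT.blockKernel (B1RT.prec a (P.mesh 1) P.d) linAvg (toSite B) (toSite A) * renormTransf C a A (ρ A) ψ

/-- The constant factors produced by the two block kernels at `k = 0` (II p. 556: *"Omitting the constant factors"*):
`((κ/2π)^{d/2})^{|T^{(1)}|} · ((κ/2π)^{N/2})^{|T^{(1)}|}`, `κ = a(L·mesh₀)^{d−2}`. [cite: Balaban1982Higgs2, (2.1) p.556] -/
noncomputable def kernelConst (P : Params) (N : ℕ) (a : ℝ) : ℝ :=
  ((B1RT.prec a (P.mesh 1) P.d / (2 * π)) ^ ((P.d : ℝ) / 2)) ^ Fintype.card (Site P 1)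
    * ((B1RT.prec a (P.mesh 1) P.d / (2 * π)) ^ ((N : ℝ) / 2)) ^ Fintype.card (Site P 1)

/-- The bracket `E` of (2.1) is the sum of the two Gaussian exponents and `−S` (regrouping; definitional up to `ring`).
[cite: Balaban1982Higgs2, (2.1) p.556] -/
theorem firstStepExponent_eq_add (C : ChargeData N) (c : Couplings) (a : ℝ) (B : VecField P 1) (ψ : ScalarField P 1 N)
    (A : VecField P 0) (φ : ScalarField P 0 N) :
    firstStepExponent C c a B ψ A φ
      = -(B1RT.prec a (P.mesh 1) P.d / 2) * ∑ y : Site P 1, ‖toSite B y - linAvg (toSite A) y‖ ^ 2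
        + -(B1RT.prec a (P.mesh 1) P.d / 2) * ∑ y : Site P 1, ‖ψ y - avgQ C A φ y‖ ^ 2
        + -action C c A φ := by
  unfold firstStepExponent
  ring

/-- **II p. 556 — from `T^ε_{a,L}[T^ε_{a,L,A}[exp(−S^ε)]]` to the bracket of (2.1); I (3.6)→(3.7) p. 613.**  For any weight
`χ(A, φ)` (the characteristic functions `χ₀(A)χ₀(φ)` of I (3.6), or `1` in II), on any lattice of the family:
`T_{a,L}[T_{a,L,A}[χ·e^{−S}]](B, ψ) = const · ∫dA ∫dφ χ(A, φ) exp E(B,ψ;A,φ)` with `E = firstStepExponent` and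
`const = kernelConst` — the kernels (2.5)–(2.6) of the two transformations contribute exactly the two Gaussian terms of
the bracket and constant factors.  PROVED (pointwise algebra of the integrands and linearity of the integral; no
convergence statement is used or made). [cite: Balaban1982Higgs2, (2.1) p.556] -/
theorem doubleRT_exp_neg_action (C : ChargeData N) (c : Couplings) (a : ℝ)
    (χ : VecField P 0 → ScalarField P 0 N → ℝ) (B : VecField P 1) (ψ : ScalarField P 1 N) :
    doubleRT C a (fun A φ => χ A φ * Real.exp (-action C c A φ)) B ψ
      = kernelConst P N a
          * ∫ A : VecField P 0, ∫ φ : ScalarField P 0 N, χ A φ * Real.exp (firstStepExponent C c a B ψ A φ) := by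
  unfold doubleRT renormTransf
  rw [← integral_const_mul]
  congr 1
  funext A
  rw [B1RT.rtOp_eq, ← integral_const_mul, ← integral_const_mul]
  congr 1
  funext φ
  rw [rtKernelStep, blockKernel_eq_const_mul_exp, blockKernel_eq_const_mul_exp, firstStepExponent_eq_add,
    Real.exp_add, Real.exp_add, kernelConst, finrank_euclideanSpace_fin, finrank_euclideanSpace_fin]
  ring

end DoubleRT

/-! ## 5. PROVED: the bracket at `mesh₀ = 1` is the printed one; the bracket is invariant under the canonical rescaling -/

section UnitForm

variable {N : ℕ}

/-- On a lattice of the family with `mesh₀ = 1` — the unit lattice `T₁` of II (2.1) / I (3.7), block lattice `T'₁` of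
spacing `L` — the bracket `E` is LITERALLY the printed one: all weights `η^d` equal `1`, the precision is `aL^{d−2}`,
`(∂A)(b)`, `(D_Aφ)(b)` are the unit-lattice difference and covariant derivatives (1.4)/(1.7), and the constants of the
action are those handed in (`m₀² = m²ε² + δm²ε²`, `λε^{4−d}`, `μ₀²ε²`, `E` at `c₁ = c.scaleBy d ε⁻¹`:
`couplings_scaleBy_inv`):
`E = −½aL^{d−2}Σ_y|B(y)−(QA)(y)|² − ½Σ_bΣ_μ((∂A_μ)(b))² − ½μ₀²Σ_b A_b² − ½aL^{d−2}Σ_y|ψ(y)−(Q(A)φ)(y)|² − ½Σ_b|(D_Aφ)(b)|²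
− ½m₀²Σ_x|φ(x)|² − λΣ_x|φ(x)|⁴ − E`. PROVED. [cite: Balaban1982Higgs2, (2.1) p.556] -/
theorem firstStepExponent_unit {P₁ : Params} (h1 : P₁.mesh 0 = 1) (C₁ : ChargeData N) (c₁ : Couplings) (a : ℝ)
    (B : VecField P₁ 1) (ψ : ScalarField P₁ 1 N) (A : VecField P₁ 0) (φ : ScalarField P₁ 0 N) :
    firstStepExponent C₁ c₁ a B ψ A φ
      = -(a * (P₁.L : ℝ) ^ ((P₁.d : ℤ) - 2) / 2) * ∑ y : Site P₁ 1, ‖toSite B y - linAvg (toSite A) y‖ ^ 2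
        - 1 / 2 * ∑ μ : Fin P₁.d, ∑ b : PBond P₁ 0, (sderiv (A.comp μ) b) ^ 2
        - c₁.mu0sq / 2 * ∑ b : PBond P₁ 0, (A b) ^ 2
        - a * (P₁.L : ℝ) ^ ((P₁.d : ℤ) - 2) / 2 * ∑ y : Site P₁ 1, ‖ψ y - avgQ C₁ A φ y‖ ^ 2
        - 1 / 2 * ∑ b : PBond P₁ 0, ‖covDeriv C₁ A φ b‖ ^ 2
        - c₁.m0sq / 2 * ∑ x : Site P₁ 0, ‖φ x‖ ^ 2 - c₁.lam * ∑ x : Site P₁ 0, ‖φ x‖ ^ 4 - c₁.E := by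
  have hL : P₁.mesh 1 = P₁.L := by
    have h := h1
    simp only [Params.mesh, pow_zero, one_mul] at h
    simp [Params.mesh, h]
  unfold firstStepExponent action covLaplaceForm vecLaplaceForm potential
  rw [h1, hL, B1RT.prec_eq]
  simp only [one_pow, one_mul, Finset.sum_add_distrib, ← Finset.mul_sum]
  ring

end UnitForm

section Rescaling

variable {k N : ℕ} {s : ℝ}

/-- (1.22) p. 607 (*"the same formulas for vector fields"*) for the `ℝ^d`-valued site function of §1:
`(rescaleVec A')(x) = s^{(d−2)/2} · A'(x)` in `ℝ^d`, i.e. `toSite ∘ rescaleVec = rescaleScalar ∘ toSite`. [cite: Balaban1982Higgs1, (1.22) p.607] -/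
theorem toSite_rescaleVec (hs : 0 < s) (A' : VecField (P.scaleBy s hs) k) :
    toSite (rescaleVec hs A') = rescaleScalar (N := P.d) hs (toSite (P := P.scaleBy s hs) A') := by
  funext x
  rfl

/-- The plain block average commutes with the rescaling (1.22) (it is linear and the blocks are the same labels):
`Q(rescaleScalar f) = rescaleScalar (Q f)`. [cite: Balaban1982Higgs1, (2.7) p.608] -/
theorem linAvg_rescaleScalar (hs : 0 < s) (f : ScalarField (P.scaleBy s hs) k N) :
    linAvg (rescaleScalar hs f) = rescaleScalar hs (linAvg (P := P.scaleBy s hs) f) := by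
  funext y
  simp only [linAvg, rescaleScalar, ← Finset.smul_sum]
  rw [smul_comm]
  rfl

/-- The sum (2.3) along a straight segment is linear in `A`: `(rescaleVec A')(⟨u, u+nεe_μ⟩) = s^{(d−2)/2} A'(…)` (same
labels on the two lattices). [cite: Balaban1982Higgs1, (2.3) p.608] -/
theorem segSum_rescaleVec (hs : 0 < s) (A' : VecField (P.scaleBy s hs) 0) (u : Site P 0) (μ : Fin P.d) (n : ℕ) :
    segSum (rescaleVec hs A') u μ n = s ^ (((P.d : ℝ) - 2) / 2) * segSum (P := P.scaleBy s hs) A' u μ n := by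
  unfold segSum
  rw [Finset.mul_sum]
  rfl

/-- The contour sum `A(Γ_{y,x})` (2.1)/(2.3) of a rescaled field: `(rescaleVec A')(Γ_{y,x}) = s^{(d−2)/2} A'(Γ_{y,x})`.
[cite: Balaban1982Higgs1, (2.3) p.608] -/
theorem contourSum_rescaleVec (hs : 0 < s) (A' : VecField (P.scaleBy s hs) 0) (y x : Site P 0) :
    contourSum (rescaleVec hs A') y x = s ^ (((P.d : ℝ) - 2) / 2) * contourSum (P := P.scaleBy s hs) A' y x := by
  unfold contourSum
  simp only [segSum_rescaleVec hs, ← Finset.mul_sum]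
  rfl

/-- **`Q(A)` under the canonical rescaling** ((1.22) with p. 607): averaging the rescaled fields on the `ε`-lattice is
the rescaling of the average of the fields on the `sε`-lattice at the rescaled charge `e_s`:
`Q(rescaleVec A')(rescaleScalar φ') = rescaleScalar (Q_{e_s}(A') φ')` — the transports satisfy
`U_e(ε·s^{(d−2)/2}A'(Γ)) = U_{e_s}((sε)·A'(Γ))` (`HiggsRescaling.U_rescale`) and `Q(A)` is linear in `φ`. PROVED. [cite: Balaban1982Higgs1, (2.7) p.608] -/
theorem avgQ_rescale (hs : 0 < s) (C : ChargeData N) (A' : VecField (P.scaleBy s hs) 0)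
    (φ' : ScalarField (P.scaleBy s hs) k N) :
    avgQ C (rescaleVec hs A') (rescaleScalar hs φ')
      = rescaleScalar hs (avgQ (P := P.scaleBy s hs) (C.scaleBy P.d s) A' φ') := by
  funext y
  rw [avgQ_apply]
  simp only [rescaleScalar]
  rw [avgQ_apply, Finset.smul_sum, Finset.smul_sum, Finset.smul_sum]
  refine Finset.sum_congr rfl fun x _ => ?_
  rw [contourSum_rescaleVec hs, U_rescale hs C 0, map_smul, smul_comm]
  rfl

/-- The Gaussian precision of (2.6) absorbs the field factor of (1.22): `a(L·ε)^{d−2} · (s^{(d−2)/2})² = a(L·sε)^{d−2}`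
— the terms `|ψ(y) − (Q(A)φ)(y)|²` of the transformation carry no weight `η^d` and are SCALE-FREE. [cite: Balaban1982Higgs1, (2.6) p.608] -/
theorem prec_mul_sq_rescale (hs : 0 < s) (a : ℝ) :
    B1RT.prec a (P.mesh 1) P.d * (s ^ (((P.d : ℝ) - 2) / 2)) ^ 2
      = B1RT.prec a ((P.scaleBy s hs).mesh 1) (P.scaleBy s hs).d := by
  have hσ : (s ^ (((P.d : ℝ) - 2) / 2)) ^ 2 = s ^ ((P.d : ℤ) - 2) := by
    rw [← Real.rpow_natCast _ 2, ← Real.rpow_mul hs.le, ← Real.rpow_intCast]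
    congr 1
    push_cast
    ring
  rw [hσ, scaleBy_d, mesh_scaleBy, B1RT.prec_eq, B1RT.prec_eq, mul_zpow]
  ring

/-- **II p. 556 / I p. 613: "We rescale it from ε-lattice T_ε to 1-lattice T₁" — the bracket of (2.1) is invariant
under the canonical rescaling (1.22) when the constants are rescaled as on I p. 607.**  For block and fine fields
`B', ψ', A', φ'` on the `sε`-lattice and their rescalings (1.22) on the `ε`-lattice,
`E^{ε}_{e,λ,m₀²,μ₀²,E}(B,ψ;A,φ) = E^{sε}_{e_s,λ_s,m₀²s⁻²,μ₀²s⁻²,E}(B',ψ';A',φ')`; at `s = ε⁻¹` the right side is the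
unit-lattice bracket with the constants `m₀²ε², λε^{4−d}, μ₀²ε², eε^{(4−d)/2}` displayed in (2.1)
(`couplings_scaleBy_inv`, `unitLattice_mesh_zero`, `firstStepExponent_unit`).  PROVED: the action part is
`HiggsRescaling.action_rescale` (the p. 607 claim), the Gaussian parts `avgQ_rescale` + `prec_mul_sq_rescale`. [cite: Balaban1982Higgs2, (2.1) p.556] -/
theorem firstStepExponent_rescale (hs : 0 < s) (C : ChargeData N) (c : Couplings) (a : ℝ)
    (B' : VecField (P.scaleBy s hs) 1) (ψ' : ScalarField (P.scaleBy s hs) 1 N)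
    (A' : VecField (P.scaleBy s hs) 0) (φ' : ScalarField (P.scaleBy s hs) 0 N) :
    firstStepExponent C c a (rescaleVec hs B') (rescaleScalar hs ψ') (rescaleVec hs A') (rescaleScalar hs φ')
      = firstStepExponent (P := P.scaleBy s hs) (C.scaleBy P.d s) (c.scaleBy P.d s) a B' ψ' A' φ' := by
  have h1 : ∑ y : Site P 1, ‖toSite (rescaleVec hs B') y - linAvg (toSite (rescaleVec hs A')) y‖ ^ 2
      = (s ^ (((P.d : ℝ) - 2) / 2)) ^ 2
          * ∑ y : Site (P.scaleBy s hs) 1, ‖toSite B' y - linAvg (toSite A') y‖ ^ 2 := by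
    rw [toSite_rescaleVec hs B', toSite_rescaleVec hs A', linAvg_rescaleScalar hs, Finset.mul_sum]
    refine Finset.sum_congr rfl fun y _ => ?_
    simp only [rescaleScalar, ← smul_sub, norm_smul, mul_pow, Real.norm_of_nonneg (Real.rpow_nonneg hs.le _)]
    rfl
  have h2 : ∑ y : Site P 1, ‖rescaleScalar hs ψ' y - avgQ C (rescaleVec hs A') (rescaleScalar hs φ') y‖ ^ 2
      = (s ^ (((P.d : ℝ) - 2) / 2)) ^ 2
          * ∑ y : Site (P.scaleBy s hs) 1, ‖ψ' y - avgQ (P := P.scaleBy s hs) (C.scaleBy P.d s) A' φ' y‖ ^ 2 := by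
    rw [avgQ_rescale hs C A' φ', Finset.mul_sum]
    refine Finset.sum_congr rfl fun y _ => ?_
    simp only [rescaleScalar]
    rw [← smul_sub, norm_smul, mul_pow, Real.norm_of_nonneg (Real.rpow_nonneg hs.le _)]
  unfold firstStepExponent
  rw [h1, h2, action_rescale hs C c A' φ', ← prec_mul_sq_rescale hs a]
  ring

end Rescaling

/-! ## 6. PROVED: the change of variables — `T T[χe^{−S}]` at rescaled block fields is a constant times the
integral of `χ exp E` over the fields of the `sε`-lattice (at `s = ε⁻¹`: *"we get the integral (I.3.7)"*) -/

section ChangeOfVariables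

variable {N : ℕ} {s : ℝ}

/-- Lebesgue measure under the rescaling (1.22) of the VECTOR fields (I p. 605 *"natural Lebesgue measure"*, p. 607):
`∫dA' G(rescaleVec A') = σ^{−|bonds|} ∫dA G(A)`, `σ = s^{(d−2)/2}` — the relabeling of the bonds is measure preserving
(`MeasureTheory.volume_measurePreserving_piCongrLeft`) and the homothety `σ·` scales Lebesgue measure by `σ^{−dim}`
(`MeasureTheory.Measure.integral_comp_smul`). PROVED. [cite: Balaban1982Higgs1, (1.22) p.607] -/
theorem integral_comp_rescaleVec {k : ℕ} (hs : 0 < s) (G : VecField P k → ℝ) :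
    ∫ A' : VecField (P.scaleBy s hs) k, G (rescaleVec hs A')
      = |((s ^ (((P.d : ℝ) - 2) / 2)) ^ Fintype.card (PBond P k))⁻¹| * ∫ A : VecField P k, G A := by
  set e : PBond (P.scaleBy s hs) k ≃ PBond P k :=
    ⟨fun b => ⟨b.src, b.dir⟩, fun b => ⟨b.src, b.dir⟩, fun _ => rfl, fun _ => rfl⟩ with he
  set Φ := MeasurableEquiv.piCongrLeft (fun _ : PBond P k => ℝ) e with hΦ
  have hmp : MeasurePreserving Φ volume volume := volume_measurePreserving_piCongrLeft (fun _ : PBond P k => ℝ) e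
  have hΦapp : ∀ (g : VecField (P.scaleBy s hs) k) (b : PBond (P.scaleBy s hs) k), Φ g (e b) = g b := by
    intro g b
    rw [hΦ, MeasurableEquiv.coe_piCongrLeft, Equiv.piCongrLeft_apply_apply]
  have hR : ∀ A' : VecField (P.scaleBy s hs) k, rescaleVec hs A' = s ^ (((P.d : ℝ) - 2) / 2) • Φ A' := by
    intro A'
    funext b
    rw [Pi.smul_apply, smul_eq_mul]
    exact congrArg (fun t => s ^ (((P.d : ℝ) - 2) / 2) * t) (hΦapp A' ⟨b.src, b.dir⟩).symm
  calc ∫ A' : VecField (P.scaleBy s hs) k, G (rescaleVec hs A')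
      = ∫ A' : VecField (P.scaleBy s hs) k,
          (fun A : VecField P k => G (s ^ (((P.d : ℝ) - 2) / 2) • A)) (Φ A') := by simp_rw [hR]
    _ = ∫ A : VecField P k, G (s ^ (((P.d : ℝ) - 2) / 2) • A) :=
          hmp.integral_comp' (fun A : VecField P k => G (s ^ (((P.d : ℝ) - 2) / 2) • A))
    _ = |((s ^ (((P.d : ℝ) - 2) / 2)) ^ Fintype.card (PBond P k))⁻¹| * ∫ A : VecField P k, G A := by
          rw [Measure.integral_comp_smul, Module.finrank_fintype_fun_eq_card, smul_eq_mul]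

/-- Lebesgue measure under the rescaling (1.22) of the SCALAR fields: `∫dφ' H(rescaleScalar φ') = σ^{−N|T|} ∫dφ H(φ)`,
`σ = s^{(d−2)/2}` (the sites are the same labels; `Measure.integral_comp_smul` on `T → ℝ^N`). PROVED. [cite: Balaban1982Higgs1, (1.22) p.607] -/
theorem integral_comp_rescaleScalar {k : ℕ} (hs : 0 < s) (H : ScalarField P k N → ℝ) :
    ∫ φ' : ScalarField (P.scaleBy s hs) k N, H (rescaleScalar hs φ')
      = |((s ^ (((P.d : ℝ) - 2) / 2)) ^ (N * Fintype.card (Site P k)))⁻¹| * ∫ φ : ScalarField P k N, H φ := by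
  have hR : ∀ φ' : ScalarField (P.scaleBy s hs) k N, rescaleScalar hs φ' = s ^ (((P.d : ℝ) - 2) / 2) • φ' :=
    fun _ => rfl
  have hfin : Module.finrank ℝ (ScalarField (P.scaleBy s hs) k N) = N * Fintype.card (Site P k) := by
    rw [Module.finrank_pi_fintype, Finset.sum_const, Finset.card_univ, finrank_euclideanSpace_fin, smul_eq_mul,
      mul_comm]
    rfl
  simp_rw [hR]
  rw [Measure.integral_comp_smul, smul_eq_mul, hfin]
  rfl

/-- The constant relating `T T[χ e^{−S}]` on the `ε`-lattice to the integral over the fields of the `sε`-lattice: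
the kernel normalizations (`kernelConst`) times the Jacobian `σ^{|bonds of T_ε|} · σ^{N|T_ε|}`, `σ = s^{(d−2)/2}`; at
`s = ε⁻¹` this is the *"const"* of I (3.7) p. 613 (omitted in II (2.1)). [cite: Balaban1982Higgs1, (3.7) p.613] -/
noncomputable def rescaleConst (P : Params) (N : ℕ) (a s : ℝ) : ℝ :=
  kernelConst P N a * ((s ^ (((P.d : ℝ) - 2) / 2)) ^ Fintype.card (PBond P 0)
    * (s ^ (((P.d : ℝ) - 2) / 2)) ^ (N * Fintype.card (Site P 0)))

/-- **II p. 556: "We have to calculate the integral T^ε_{a,L}[T^ε_{a,L,A}[exp(−S^ε)]]. We rescale it from ε-lattice T_ε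
to 1-lattice T₁ and we get the integral (I.3.7)"** (I p. 613: *"This integral is rescaled from the ε-lattice to the unit
lattice, i.e. we make the transformations (1.22), (1.23) with η = ε, δ = 1. After the rescaling the integral gets the
following form const ∫dA∫dφ χ₀(A)χ₀(φ) exp[…] (3.7)"*) — typed reading, for a general factor `s > 0` (`s = ε⁻¹` in
print) and weight `χ`: the double transformation of `χ·e^{−S^ε}` on the `ε`-lattice, evaluated at the rescalings
(1.22) of block fields `B', ψ'` of the `sε`-lattice, equals `rescaleConst` times the integral over the fine fields
`A', φ'` of the `sε`-lattice of `χ(rescaled fields) · exp E^{sε}(B',ψ';A',φ')` with the rescaled constants — which at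
`s = ε⁻¹` is `display37` (`χ₀` present) / `display21` (`χ ≡ 1`, constant dropped) by `firstStepExponent_unit`,
`unitLattice_mesh_zero`, `couplings_scaleBy_inv`.  PROVED from `doubleRT_exp_neg_action`, `firstStepExponent_rescale`
and the two change-of-variables lemmas; no convergence is used (both sides are Bochner integrals of the same functions
up to the measure-preserving relabeling and a homothety). [cite: Balaban1982Higgs2, (2.1) p.556] -/
theorem doubleRT_rescale (hs : 0 < s) (C : ChargeData N) (c : Couplings) (a : ℝ)
    (χ : VecField P 0 → ScalarField P 0 N → ℝ)
    (B' : VecField (P.scaleBy s hs) 1) (ψ' : ScalarField (P.scaleBy s hs) 1 N) :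
    doubleRT C a (fun A φ => χ A φ * Real.exp (-action C c A φ)) (rescaleVec hs B') (rescaleScalar hs ψ')
      = rescaleConst P N a s
          * ∫ A' : VecField (P.scaleBy s hs) 0, ∫ φ' : ScalarField (P.scaleBy s hs) 0 N,
              χ (rescaleVec hs A') (rescaleScalar hs φ')
                * Real.exp (firstStepExponent (P := P.scaleBy s hs) (C.scaleBy P.d s) (c.scaleBy P.d s) a
                    B' ψ' A' φ') := by
  rw [doubleRT_exp_neg_action]
  have h1 : (∫ A' : VecField (P.scaleBy s hs) 0, ∫ φ' : ScalarField (P.scaleBy s hs) 0 N,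
        χ (rescaleVec hs A') (rescaleScalar hs φ')
          * Real.exp (firstStepExponent (P := P.scaleBy s hs) (C.scaleBy P.d s) (c.scaleBy P.d s) a B' ψ' A' φ'))
      = |((s ^ (((P.d : ℝ) - 2) / 2)) ^ Fintype.card (PBond P 0))⁻¹|
          * ∫ A : VecField P 0, ∫ φ' : ScalarField (P.scaleBy s hs) 0 N,
              χ A (rescaleScalar hs φ')
                * Real.exp (firstStepExponent C c a (rescaleVec hs B') (rescaleScalar hs ψ') A
                    (rescaleScalar hs φ')) := by
    rw [← integral_comp_rescaleVec hs]
    simp_rw [firstStepExponent_rescale]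
  have h2 : ∀ A : VecField P 0,
      (∫ φ' : ScalarField (P.scaleBy s hs) 0 N,
          χ A (rescaleScalar hs φ')
            * Real.exp (firstStepExponent C c a (rescaleVec hs B') (rescaleScalar hs ψ') A (rescaleScalar hs φ')))
        = |((s ^ (((P.d : ℝ) - 2) / 2)) ^ (N * Fintype.card (Site P 0)))⁻¹|
            * ∫ φ : ScalarField P 0 N,
                χ A φ * Real.exp (firstStepExponent C c a (rescaleVec hs B') (rescaleScalar hs ψ') A φ) :=
    fun A => integral_comp_rescaleScalar hs
      (fun φ => χ A φ * Real.exp (firstStepExponent C c a (rescaleVec hs B') (rescaleScalar hs ψ') A φ))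
  rw [h1]
  simp_rw [h2]
  rw [integral_const_mul]
  have hσ : 0 < s ^ (((P.d : ℝ) - 2) / 2) := Real.rpow_pos_of_pos hs _
  have hn1 : 0 < (s ^ (((P.d : ℝ) - 2) / 2)) ^ Fintype.card (PBond P 0) := pow_pos hσ _
  have hn2 : 0 < (s ^ (((P.d : ℝ) - 2) / 2)) ^ (N * Fintype.card (Site P 0)) := pow_pos hσ _
  rw [abs_of_pos (inv_pos.mpr hn1), abs_of_pos (inv_pos.mpr hn2)]
  unfold rescaleConst
  field_simp

end ChangeOfVariables

end Literature.MathematicalPhysics.QuantumFieldTheory.Balaban1983to89.B2Eq21FirstStep
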